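import Summits.BirchSwinnertonDyer.BirchSwinnertonDyer.Theses.SelmerRank
import Literature.NumberTheory.EllipticCurves.SelmerCorankHolds
import HarnessLib

set_option linter.dupNamespace false -- `…BirchSwinnertonDyer.BirchSwinnertonDyer…` is the cell's nested layout (D-0017)
set_option autoImplicit false

/-!
# Item 10874 `SelmerRankCorankIdentity` (route `SelmerRank`, support 9) — `corank_{ℤ_p} Sel_{p^∞}(E/ℚ) = rank E(ℚ) + corank_{ℤ_p} Ш(E/ℚ)[p^∞]`
# for every `E/ℚ` and every prime `p` (Greenberg LNM 1716 §1) — PROVED BY NAME (INPUTS idle-prover sweep)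

Seat `bsd-inputs-honda-p1` (gen 6, idle INPUTS prover of the desk `pub/bsd-wall/bsd-inputs`), `--workitem` stmt-BirchSwinnertonDyer-10874.
THEOREMS ONLY (no definition, no named fact, no `sorry`).

The item is `∀ (W : WeierstrassCurve ℚ), W.selmerCorank_eq_mordellWeilRank_add` — the named fact of `Literature/…/Selmer.lean` (from the
Kummer sequence `0 → E(K) ⊗ ℚ_p/ℤ_p → Sel_{p^∞}(E/K) → Ш(E/K)[p^∞] → 0`, Mordell–Weil and the finiteness of the `n`-Selmer groups), which
HAS its hypothesis-free discharge in the tree for every number field: `WeierstrassCurve.selmerCorank_eq_mordellWeilRank_add_holds (W)`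
(`Literature/NumberTheory/EllipticCurves/SelmerCorankHolds.lean`: `…_of_finite_selmerGroup` fed with `finite_selmerGroup_holds`, Silverman
*AEC* X.4.2 (b)). The route's own docstring records the intended one-line proof `fun W => W.selmerCorank_eq_mordellWeilRank_add_holds` and
asks for it in a `Theorems` file importing `SelmerCorankHolds` (so the route file keeps its light imports); this is that file. Nothing is
re-derived; no landed declaration is restated.

Honest framing: UNCONDITIONAL (kernel theorem of the tree, re-typed as the route declaration). Closing item 10874 makes the `SelmerRank`
route's `closes` unconditional in this input AS TYPED only; no crux and no summit statement is proved; the Birch–Swinnerton-Dyer conjecture is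
NOT proved by any of this. References: [Greenberg1999LNM] §1 pp. 54–57; [SilvermanAEC2009] Thm. X.4.2 (b).
-/

namespace Summit.BirchSwinnertonDyer.BirchSwinnertonDyer.Theorems.InputsSweep

/-- **Item 10874 on route `SelmerRank` — `SelmerRankCorankIdentity` PROVED (by name):** for every `W/ℚ` (elliptic) and every prime `p`,
`selmerCorank W p = mordellWeilRank W + shaCorank W p`, from `WeierstrassCurve.selmerCorank_eq_mordellWeilRank_add_holds`. Unconditional;
closes item 10874; BSD is not proved by this. [cite: Greenberg1999LNM, §1 pp. 54–57] [cite: SilvermanAEC2009, Thm. X.4.2 (b)] -/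
theorem selmerRank_selmerRankCorankIdentity_proof :
    Summit.BirchSwinnertonDyer.BirchSwinnertonDyer.Theses.SelmerRank.SelmerRankCorankIdentity := by
  unfold Summit.BirchSwinnertonDyer.BirchSwinnertonDyer.Theses.SelmerRank.SelmerRankCorankIdentity
  exact fun W => W.selmerCorank_eq_mordellWeilRank_add_holds

end Summit.BirchSwinnertonDyer.BirchSwinnertonDyer.Theorems.InputsSweep
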